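import Literature.NumberTheory.Automorphic.U3JacquetVanishingSupercuspidal
import Mathlib.LinearAlgebra.Matrix.IsDiag
import HarnessLib

/-!
# The one-place model `U(Φ₃)(L⁺_v) ≃ₜ* U(σ_w, Φ₃)(L_w)` at a non-split place respects the Borel pair: torus ↔ torus, radical ↔ radical,
# centre ↔ centre (Platonov–Rapinchuk §5.1; Rogawski §1.10)

Topic `NumberTheory/Automorphic`; namespace `Literature.NumberTheory.Automorphic.UnitaryGroup`.  THEOREMS ONLY (no definition, no named fact,
no instance, no notation, no `sorry`).  Cell `hodgecm-mathlib`, F0∕P3 «U3-mult», N5 road (★ `UnitaryGroup.U3SquareIntegrableExponents`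
[Casselman1995, Thm. 4.4.6]), file (R5b-cm) of the GROUP∕MEASURE half (seat B-p04 (g31)).

THE POINT.  The letter N5 lives on the CM carrier `G = U(Φ₃)(L⁺_v) = ↥(unitaryGroupOfForm (c ⊗ 1) (cmLocalForm L 3 v))` (`LocalRing L v = ∏_{w ∣ v} L_w`
is a Π-type, not a `Field`) with the FIXED Borel triple ★ `cmBorelTriple L 3 v`, while the structure theory of the road (Iwahori data, the Cartan
decomposition ★ `exists_cartan_of_involution`, heights) is proved over a valued FIELD, i.e. on the ONE-PLACE MODEL `U(σ_w, Φ₃)(L_w)` reached through the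
topological isomorphism ★ `localNonsplitEquiv` (`e`, «entries evaluated at the unique `w ∣ v`», ★ `coe_localNonsplitEquiv_apply`) — exactly as in
the N6 proof ★ `Rogawski1990.u3_isSupercuspidal_iff_jacquet_eq_zero_mpr`.  To transport an Iwahori factorisation `K′ = (K′ ∩ N̄′)(K′ ∩ T′)(K′ ∩ N′)`
and dominance data from the model back to `G` with the FIXED `T = (cmBorelTriple L 3 v).M`, `N = (cmBorelTriple L 3 v).N`, one needs that `e`
identifies the tori and the radicals on the nose:
* §1 (generic, any commutative ring) **`mem_range_glDiagonal_iff_isDiag`**: `g ∈ GL_N(R)` is `diag(d)` for units `d` iff its matrix is diagonal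
  (the diagonal entries divide `det g`, hence are units).
* §2 (CM, non-split `v`, `w ∣ v`) **`localNonsplitEquiv_mem_torusU_iff`** (`e g ∈ T′ ↔ g ∈ T`), **`comap_localNonsplitEquiv_torusU`**
  (`T′.comap e = (cmBorelTriple L 3 v).M`); **`localNonsplitEquiv_mem_unipotentU_iff`** ∕ **`comap_localNonsplitEquiv_unipotentU`** (`N′.comap e =
  (cmBorelTriple L 3 v).N`, both inclusions ★: `localNonsplitEquiv_mem_unipotentU`, `localNonsplitEquiv_symm_mem_cmBorelTriple_N`);
  **`localNonsplitEquiv_mem_center_iff`** ∕ **`comap_localNonsplitEquiv_center`** (centre ↔ centre, ★ `localNonsplitEquiv_mem_center` + symmetry).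
With these, `comap e` of a model Iwahori factorisation `K′ = (K′ ∩ N̄′)(K′ ∩ T′)(K′ ∩ N′)` is a factorisation `K = (K ∩ N̄)(K ∩ T)(K ∩ N)` of
`K = K′.comap e` for the CM triple with `N̄ := N̄′.comap e` (sequel R5b-gen, generic in a group isomorphism), and the Cartan decomposition ∕ centre
containment transport verbatim.  HC_CM is proved only modulo the printed citations until rung 0 closes; this file is count-neutral.

## References
* [PlatonovRapinchuk1994] V. Platonov, A. Rapinchuk, *Algebraic Groups and Number Theory* (1994), §5.1 (`G_{F_v}` for `v` non-split: the
  one-place model), §2.3.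
* [Rogawski1990] J. D. Rogawski, *Automorphic Representations of Unitary Groups in Three Variables*, Ann. of Math. Stud. 123 (1990), §1.10 p. 9
  (`B = MN`, `M = {d(α, β, ᾱ⁻¹)}`, `N = {u(x, z)}`).
* [Casselman1995] W. Casselman, *Introduction to the theory of admissible representations of `p`-adic reductive groups* (1995), Prop. 1.4.4, Thm. 4.4.6.
-/

set_option autoImplicit false

open scoped MatrixGroups Matrix
open Matrix

namespace Literature.NumberTheory.Automorphic

namespace UnitaryGroup

/-! ## §1 `g ∈ diag(units) ↔ g` is a diagonal matrix -/

section Generic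

variable {R : Type*} [CommRing R] {N : ℕ}

/-- **An invertible matrix is `diag(d)` for units `d` iff it is diagonal**: the diagonal entries of a diagonal `g ∈ GL_N(R)` divide
`det g = ∏ᵢ gᵢᵢ`, a unit. [cite: PlatonovRapinchuk1994, §2.3] -/
theorem mem_range_glDiagonal_iff_isDiag (g : GL (Fin N) R) :
    g ∈ (glDiagonal N R).range ↔ ((g : GL (Fin N) R) : Matrix (Fin N) (Fin N) R).IsDiag := by
  classical
  constructor
  · rintro ⟨d, rfl⟩
    rw [coe_glDiagonal]
    exact Matrix.isDiag_diagonal _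
  · intro h
    have hdiag : Matrix.diagonal (fun i => (g : Matrix (Fin N) (Fin N) R) i i) = (g : Matrix (Fin N) (Fin N) R) :=
      h.diagonal_diag
    have hdet : IsUnit ((g : Matrix (Fin N) (Fin N) R)).det := ⟨Matrix.GeneralLinearGroup.det g, rfl⟩
    have hprod : ((g : Matrix (Fin N) (Fin N) R)).det = ∏ i, (g : Matrix (Fin N) (Fin N) R) i i := by
      rw [← hdiag, Matrix.det_diagonal]
      simp only [Matrix.diagonal_apply_eq]
    rw [hprod] at hdet
    have hunit : ∀ i, IsUnit ((g : Matrix (Fin N) (Fin N) R) i i) := fun i =>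
      isUnit_of_dvd_unit (Finset.dvd_prod_of_mem (fun k => (g : Matrix (Fin N) (Fin N) R) k k) (Finset.mem_univ i)) hdet
    refine ⟨fun i => (hunit i).unit, Units.ext ?_⟩
    have hfun : (fun k => (((hunit k).unit : Rˣ) : R)) = fun k => (g : Matrix (Fin N) (Fin N) R) k k :=
      funext fun k => (hunit k).unit_spec
    rw [coe_glDiagonal, hfun, hdiag]

end Generic

/-! ## §2 The CM one-place model respects torus, radical and centre -/

section CM

open _root_.NumberField _root_.IsDedekindDomain

variable (L : Type) [Field L] [NumberField L] [IsCMField L] (v : HeightOneSpectrum (𝓞 ↥(maximalRealSubfield L)))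
  (w : PlacesOver L v) (hw : IsCMField.complexConj L • w.1 = w.1)

/-- Entry formula for the one-place model: `(e g)ᵢⱼ = gᵢⱼ(w)` (★ `coe_localNonsplitEquiv_apply`). [cite: PlatonovRapinchuk1994, §5.1] -/
theorem localNonsplitEquiv_apply_apply (g : «local» L (IsCMField.complexConj L) 3 (Rogawski1990.qsForm L) v) (i j : Fin 3) :
    (((localNonsplitEquiv (IsCMField.complexConj L) (Rogawski1990.qsForm L) (IsCMField.complexConj_ne_one L) w hw g :
        ↥(unitaryGroupOfForm (galAdicCompletionMap (L := L) (IsCMField.complexConj L) hw) (placeForm (Rogawski1990.qsForm L) w.1))) :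
          GL (Fin 3) (w.1.adicCompletion L)) : Matrix (Fin 3) (Fin 3) (w.1.adicCompletion L)) i j =
      (((g : «local» L (IsCMField.complexConj L) 3 (Rogawski1990.qsForm L) v) : GL (Fin 3) (LocalRing L v)) :
        Matrix (Fin 3) (Fin 3) (LocalRing L v)) i j w := by
  have h := congr_fun (congr_fun (coe_localNonsplitEquiv_apply L (Rogawski1990.qsForm L) v w hw g) i) j
  rw [h, Matrix.map_apply, Pi.evalRingHom_apply]

include hw in
/-- At a non-split `v` an entry of a matrix over `∏_{w′ ∣ v} L_{w′}` vanishes iff its `w`-component does (one place above `v`).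
[cite: PlatonovRapinchuk1994, §5.1] -/
theorem apply_eq_zero_iff_apply_apply_eq_zero (x : LocalRing L v) : x = 0 ↔ x w = 0 := by
  haveI : Subsingleton (PlacesOver L v) :=
    PlacesOver.subsingleton_of_smul_eq (IsCMField.complexConj L) (IsCMField.complexConj_ne_one L) w hw
  constructor
  · intro h; rw [h]; rfl
  · intro h
    funext w'
    obtain rfl : w' = w := Subsingleton.elim _ _
    exact h

/-- **Torus ↔ torus**: `e g ∈ T(L_w) ↔ g ∈ T(L⁺_v) = (cmBorelTriple L 3 v).M` (both are «the matrix is diagonal», §1, read entrywise at `w`).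
[cite: PlatonovRapinchuk1994, §5.1] [cite: Rogawski1990, §1.10 p. 9] -/
theorem localNonsplitEquiv_mem_torusU_iff (g : «local» L (IsCMField.complexConj L) 3 (Rogawski1990.qsForm L) v) :
    localNonsplitEquiv (IsCMField.complexConj L) (Rogawski1990.qsForm L) (IsCMField.complexConj_ne_one L) w hw g ∈
        torusU (galAdicCompletionMap (L := L) (IsCMField.complexConj L) hw) (placeForm (Rogawski1990.qsForm L) w.1) ↔
      g ∈ (cmBorelTriple L 3 v).M := by
  have hL : localNonsplitEquiv (IsCMField.complexConj L) (Rogawski1990.qsForm L) (IsCMField.complexConj_ne_one L) w hw g ∈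
        torusU (galAdicCompletionMap (L := L) (IsCMField.complexConj L) hw) (placeForm (Rogawski1990.qsForm L) w.1) ↔
      (((localNonsplitEquiv (IsCMField.complexConj L) (Rogawski1990.qsForm L) (IsCMField.complexConj_ne_one L) w hw g :
        ↥(unitaryGroupOfForm (galAdicCompletionMap (L := L) (IsCMField.complexConj L) hw) (placeForm (Rogawski1990.qsForm L) w.1))) :
          GL (Fin 3) (w.1.adicCompletion L)) : Matrix (Fin 3) (Fin 3) (w.1.adicCompletion L)).IsDiag :=
    (mem_torusU_iff _).trans (MonoidHom.mem_range.symm.trans (mem_range_glDiagonal_iff_isDiag _))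
  have hR : g ∈ (cmBorelTriple L 3 v).M ↔
      (((g : «local» L (IsCMField.complexConj L) 3 (Rogawski1990.qsForm L) v) : GL (Fin 3) (LocalRing L v)) :
        Matrix (Fin 3) (Fin 3) (LocalRing L v)).IsDiag :=
    (mem_torusU_iff (σ := conjLocal L (IsCMField.complexConj L) v) (J := cmLocalForm L 3 v) g).trans
      (MonoidHom.mem_range.symm.trans (mem_range_glDiagonal_iff_isDiag _))
  rw [hL, hR]
  simp only [Matrix.IsDiag, Pairwise]
  refine forall_congr' fun i => forall_congr' fun j => imp_congr_right fun _ => ?_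
  rw [localNonsplitEquiv_apply_apply, ← apply_eq_zero_iff_apply_apply_eq_zero L v w hw]

/-- **`T(L_w).comap e = (cmBorelTriple L 3 v).M`**. [cite: PlatonovRapinchuk1994, §5.1] [cite: Rogawski1990, §1.10 p. 9] -/
theorem comap_localNonsplitEquiv_torusU :
    (torusU (galAdicCompletionMap (L := L) (IsCMField.complexConj L) hw) (placeForm (Rogawski1990.qsForm L) w.1)).comap
        (localNonsplitEquiv (IsCMField.complexConj L) (Rogawski1990.qsForm L) (IsCMField.complexConj_ne_one L) w hw :
          «local» L (IsCMField.complexConj L) 3 (Rogawski1990.qsForm L) v →*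
            ↥(unitaryGroupOfForm (galAdicCompletionMap (L := L) (IsCMField.complexConj L) hw) (placeForm (Rogawski1990.qsForm L) w.1))) =
      (cmBorelTriple L 3 v).M := by
  ext g
  rw [Subgroup.mem_comap]
  exact localNonsplitEquiv_mem_torusU_iff L v w hw g

/-- **Radical ↔ radical**: `e g ∈ N(L_w) ↔ g ∈ N(L⁺_v) = (cmBorelTriple L 3 v).N` (★ `localNonsplitEquiv_mem_unipotentU`, ★
`localNonsplitEquiv_symm_mem_cmBorelTriple_N`). [cite: PlatonovRapinchuk1994, §5.1] [cite: Rogawski1990, §1.10 p. 9] -/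
theorem localNonsplitEquiv_mem_unipotentU_iff (g : «local» L (IsCMField.complexConj L) 3 (Rogawski1990.qsForm L) v) :
    localNonsplitEquiv (IsCMField.complexConj L) (Rogawski1990.qsForm L) (IsCMField.complexConj_ne_one L) w hw g ∈
        unipotentU (galAdicCompletionMap (L := L) (IsCMField.complexConj L) hw) (placeForm (Rogawski1990.qsForm L) w.1) ↔
      g ∈ (cmBorelTriple L 3 v).N := by
  constructor
  · intro h
    have h' := localNonsplitEquiv_symm_mem_cmBorelTriple_N L v w hw h
    rwa [ContinuousMulEquiv.symm_apply_apply] at h'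
  · exact fun h => localNonsplitEquiv_mem_unipotentU L v w hw h

/-- **`N(L_w).comap e = (cmBorelTriple L 3 v).N`**. [cite: PlatonovRapinchuk1994, §5.1] [cite: Rogawski1990, §1.10 p. 9] -/
theorem comap_localNonsplitEquiv_unipotentU :
    (unipotentU (galAdicCompletionMap (L := L) (IsCMField.complexConj L) hw) (placeForm (Rogawski1990.qsForm L) w.1)).comap
        (localNonsplitEquiv (IsCMField.complexConj L) (Rogawski1990.qsForm L) (IsCMField.complexConj_ne_one L) w hw :
          «local» L (IsCMField.complexConj L) 3 (Rogawski1990.qsForm L) v →*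
            ↥(unitaryGroupOfForm (galAdicCompletionMap (L := L) (IsCMField.complexConj L) hw) (placeForm (Rogawski1990.qsForm L) w.1))) =
      (cmBorelTriple L 3 v).N := by
  ext g
  rw [Subgroup.mem_comap]
  exact localNonsplitEquiv_mem_unipotentU_iff L v w hw g

/-- **Centre ↔ centre**: `e z ∈ Z(U(σ_w,Φ₃)(L_w)) ↔ z ∈ Z(U(Φ₃)(L⁺_v))` (★ `localNonsplitEquiv_mem_center` and its inverse along `e.symm`).
[cite: PlatonovRapinchuk1994, §5.1] -/
theorem localNonsplitEquiv_mem_center_iff (z : «local» L (IsCMField.complexConj L) 3 (Rogawski1990.qsForm L) v) :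
    localNonsplitEquiv (IsCMField.complexConj L) (Rogawski1990.qsForm L) (IsCMField.complexConj_ne_one L) w hw z ∈
        Subgroup.center ↥(unitaryGroupOfForm (galAdicCompletionMap (L := L) (IsCMField.complexConj L) hw) (placeForm (Rogawski1990.qsForm L) w.1)) ↔
      z ∈ Subgroup.center («local» L (IsCMField.complexConj L) 3 (Rogawski1990.qsForm L) v) := by
  refine ⟨fun hz => ?_, fun hz => localNonsplitEquiv_mem_center (IsCMField.complexConj L) (Rogawski1990.qsForm L) v
    (IsCMField.complexConj_ne_one L) w hw hz⟩
  rw [Subgroup.mem_center_iff] at hz ⊢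
  intro g
  apply (localNonsplitEquiv (IsCMField.complexConj L) (Rogawski1990.qsForm L) (IsCMField.complexConj_ne_one L) w hw).injective
  rw [map_mul, map_mul]
  exact hz _

/-- **`Z(U(σ_w,Φ₃)(L_w)).comap e = Z(U(Φ₃)(L⁺_v))`**. [cite: PlatonovRapinchuk1994, §5.1] -/
theorem comap_localNonsplitEquiv_center :
    (Subgroup.center ↥(unitaryGroupOfForm (galAdicCompletionMap (L := L) (IsCMField.complexConj L) hw) (placeForm (Rogawski1990.qsForm L) w.1))).comap
        (localNonsplitEquiv (IsCMField.complexConj L) (Rogawski1990.qsForm L) (IsCMField.complexConj_ne_one L) w hw :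
          «local» L (IsCMField.complexConj L) 3 (Rogawski1990.qsForm L) v →*
            ↥(unitaryGroupOfForm (galAdicCompletionMap (L := L) (IsCMField.complexConj L) hw) (placeForm (Rogawski1990.qsForm L) w.1))) =
      Subgroup.center («local» L (IsCMField.complexConj L) 3 (Rogawski1990.qsForm L) v) := by
  ext z
  rw [Subgroup.mem_comap]
  exact localNonsplitEquiv_mem_center_iff L v w hw z

/-- **Image form of the Cartan decomposition's centre clause**: `e.symm z ∈ Z(U(Φ₃)(L⁺_v))` for `z ∈ Z(U(σ_w,Φ₃)(L_w))` — the shape in which ★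
`exists_cartan_of_involution`'s `∃ z ∈ Subgroup.center _, g = k₁ * a ^ n * k₂ * z` is pulled back to the CM carrier. [cite: PlatonovRapinchuk1994, §5.1] -/
theorem localNonsplitEquiv_symm_mem_center
    {z : ↥(unitaryGroupOfForm (galAdicCompletionMap (L := L) (IsCMField.complexConj L) hw) (placeForm (Rogawski1990.qsForm L) w.1))}
    (hz : z ∈ Subgroup.center ↥(unitaryGroupOfForm (galAdicCompletionMap (L := L) (IsCMField.complexConj L) hw) (placeForm (Rogawski1990.qsForm L) w.1))) :
    (localNonsplitEquiv (IsCMField.complexConj L) (Rogawski1990.qsForm L) (IsCMField.complexConj_ne_one L) w hw).symm z ∈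
      Subgroup.center («local» L (IsCMField.complexConj L) 3 (Rogawski1990.qsForm L) v) := by
  rw [← localNonsplitEquiv_mem_center_iff L v w hw, ContinuousMulEquiv.apply_symm_apply]
  exact hz

end CM

end UnitaryGroup

end Literature.NumberTheory.Automorphic
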